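import Literature.AlgebraicGeometry.ModuliOfAbelianVarieties.SiegelComplexRecordSystem
import Literature.NumberTheory.Automorphic.GLnAdelicStructure
import Literature.NumberTheory.Automorphic.AdeleRingTopology
import Mathlib.LinearAlgebra.FreeModule.PID
import Mathlib.LinearAlgebra.Matrix.GeneralLinearGroup.Defs
import HarnessLib

/-!
# Compact subgroups of `GL_n(𝔸_{ℚ,f})` stabilise a lattice: they are `GL_n(ℚ)`-conjugate into
# `GL_n(ℤ̂)`

Topic `Literature/NumberTheory/Adeles`; theorems only (no definition, no named fact).

**Theorem** (`exists_rat_conj_subset_integral`).  Let `C ≤ GL_n(𝔸_{ℚ,f})` be a compact subgroup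
(`n` a finite index type).  Then there is `γ ∈ GL_n(ℚ)` with `γ C γ⁻¹ ≤ GL_n(ℤ̂)`: for every
`c ∈ C` the finite-adelic matrices `γ c γ⁻¹` and `γ c⁻¹ γ⁻¹` have entries in `ℤ̂ = ∏_p ℤ_p`
(`IsCongOne 1` in the currency of the Siegel levels of `SiegelComplexRecordSystem`).  Equivalently
the full `ℤ`-lattice `Λ = γ⁻¹ ℤⁿ ⊆ ℚⁿ` satisfies `c • Λ̂ = Λ̂` for all `c ∈ C`
(Platonov–Rapinchuk, *Algebraic groups and number theory*, Prop. 8.? / the class number of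
`GL_n` over `ℚ` is one; Shimura, *Introduction to the arithmetic theory of automorphic functions*,
Lemma 6.?; Borel, *Introduction aux groupes arithmétiques*, §8).

## Proof

`GL_n(ℤ̂)` is an OPEN subgroup (`ℤ̂` is open in `𝔸_{ℚ,f}`), so the compact `C` is covered by
finitely many cosets `dᵢ · GL_n(ℤ̂)`, `dᵢ ∈ C` (`exists_finset_cosets_of_isCompact`).  The set
`L̂ = {x ∈ 𝔸_fⁿ | c x ∈ ℤ̂ⁿ for all c ∈ C}` is then squeezed `N ℤ̂ⁿ ⊆ L̂ ⊆ ℤ̂ⁿ` for a common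
denominator `N` of the `dᵢ`, and is `C`-stable by construction.  Its rational points
`Λ = {q ∈ ℚⁿ | c q ∈ ℤ̂ⁿ ∀ c ∈ C}` form a subgroup with `N ℤⁿ ⊆ Λ ⊆ ℤⁿ` (`ℚ ∩ ℤ̂ = ℤ`), free of
rank `n` over the PID `ℤ` (`nonempty_basis_of_sandwiched`); a `ℤ`-basis of `Λ` is the matrix
`B = γ⁻¹ ∈ GL_n(ℚ)`.  Strong approximation `𝔸_f = ℚ + N ℤ̂` (the tree's
`FiniteAdeleRing.exists_forall_sub_algebraMap_mem`) gives `L̂ = B ℤ̂ⁿ`, whence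
`B⁻¹ c B ℤ̂ⁿ ⊆ ℤ̂ⁿ` for `c ∈ C`, i.e. `γ c γ⁻¹` is integral.

Consumer: the receptacle line of the I-1′ crux (cell hodgecm-mathlib, B-plan2 leaf Q6a): a
compact level `ũ(K × L₀) ≤ GSp_{2g}(𝔸_{ℚ,f})` stabilises an integral symplectic lattice, on which
the Frobenius normal form ★ `exists_frobeniusBasis_toMatrix` produces the frame.

## References
* V. Platonov, A. Rapinchuk, *Algebraic groups and number theory*, Academic Press 1994, §8.1
  (class number of `GL_n` over `ℚ` is `1`; compact subgroups fix lattices). [PlatonovRapinchuk1994]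
* J. W. S. Cassels, A. Fröhlich (eds.), *Algebraic Number Theory* (1967), Ch. II §§14–15
  (`𝔸_f = K + ∏ 𝔬_v`). [CasselsFrohlichANT1967]
-/

noncomputable section

open scoped Matrix
open NumberField IsDedekindDomain Matrix
open Literature.NumberTheory.Automorphic (integralFiniteAdeles mem_integralFiniteAdeles_iff
  isOpen_integralFiniteAdeles exists_algebraMap_eq_of_forall_coe_mem)
open Literature.AlgebraicGeometry.ModuliOfAbelianVarieties (finAdeleQ IsCongOne levelIdeal
  mem_levelIdeal_iff)

namespace Literature.NumberTheory.Adeles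

universe u

variable {n : Type} [Fintype n] [DecidableEq n]

/-! ### §1. `GL_n(𝒪̂)` is open; a compact subgroup meets finitely many of its cosets -/

section General

variable (K : Type) [Field K] [NumberField K]

/-- `GL_n(𝒪̂_K) = {g : g, g⁻¹ integral}` is OPEN in `GL_n(𝔸_{K,f})` (`𝒪̂_K` is open; units of an
open submonoid of matrices are open). [cite: CasselsFrohlichANT1967, Ch. II §14] -/
theorem isOpen_units_matrix_integralFiniteAdeles :
    IsOpen (((integralFiniteAdeles K).matrix.toSubmonoid.units :
      Subgroup (GL n (FiniteAdeleRing (𝓞 K) K))) : Set (GL n (FiniteAdeleRing (𝓞 K) K))) :=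
  Submonoid.isOpen_units (isOpen_integralFiniteAdeles K).matrix

/-- Membership in `GL_n(𝒪̂_K)`: all entries of `g` and of `g⁻¹` are integral (definitional).
[cite: CasselsFrohlichANT1967, Ch. II §14] -/
theorem mem_units_matrix_integralFiniteAdeles_iff {g : GL n (FiniteAdeleRing (𝓞 K) K)} :
    g ∈ ((integralFiniteAdeles K).matrix.toSubmonoid.units :
        Subgroup (GL n (FiniteAdeleRing (𝓞 K) K))) ↔
      (∀ i j, (g : Matrix n n (FiniteAdeleRing (𝓞 K) K)) i j ∈ integralFiniteAdeles K) ∧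
        ∀ i j, ((g⁻¹ : GL n (FiniteAdeleRing (𝓞 K) K)) : Matrix n n (FiniteAdeleRing (𝓞 K) K)) i j ∈
          integralFiniteAdeles K :=
  Iff.rfl

/-- **A compact subgroup of `GL_n(𝔸_{K,f})` is a finite union of cosets of `C ∩ GL_n(𝒪̂_K)`**:
there is a finite set `s ⊆ C` such that every `c ∈ C` is `d u` with `d ∈ s` and `u ∈ GL_n(𝒪̂_K)`
(the cosets `d · GL_n(𝒪̂_K)` are an open cover of the compact `C`).
[cite: PlatonovRapinchuk1994, §8.1] -/
theorem exists_finset_cosets_of_isCompact (C : Subgroup (GL n (FiniteAdeleRing (𝓞 K) K)))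
    (hC : IsCompact (C : Set (GL n (FiniteAdeleRing (𝓞 K) K)))) :
    ∃ s : Finset (GL n (FiniteAdeleRing (𝓞 K) K)), (∀ d ∈ s, d ∈ C) ∧
      ∀ c ∈ C, ∃ d ∈ s, d⁻¹ * c ∈ ((integralFiniteAdeles K).matrix.toSubmonoid.units :
        Subgroup (GL n (FiniteAdeleRing (𝓞 K) K))) := by
  classical
  set U := ((integralFiniteAdeles K).matrix.toSubmonoid.units :
    Subgroup (GL n (FiniteAdeleRing (𝓞 K) K))) with hU
  -- the open cover `c ↦ {x | c⁻¹ x ∈ U}` of `C`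
  let V : GL n (FiniteAdeleRing (𝓞 K) K) → Set (GL n (FiniteAdeleRing (𝓞 K) K)) :=
    fun d => {x | d⁻¹ * x ∈ U}
  have hVopen : ∀ d, IsOpen (V d) := fun d =>
    (isOpen_units_matrix_integralFiniteAdeles (n := n) K).preimage (continuous_const_mul d⁻¹)
  have hcover : (C : Set (GL n (FiniteAdeleRing (𝓞 K) K))) ⊆ ⋃ d ∈ (C : Set _), V d := by
    intro c hc
    refine Set.mem_iUnion₂.mpr ⟨c, hc, ?_⟩
    show c⁻¹ * c ∈ U
    rw [inv_mul_cancel]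
    exact U.one_mem
  obtain ⟨s, hsC, hsfin, hscover⟩ := hC.elim_finite_subcover_image (fun d _ => hVopen d) hcover
  refine ⟨hsfin.toFinset, fun d hd => hsC (hsfin.mem_toFinset.mp hd), fun c hc => ?_⟩
  obtain ⟨d, hd, hcd⟩ := Set.mem_iUnion₂.mp (hscover hc)
  exact ⟨d, hsfin.mem_toFinset.mpr hd, hcd⟩

/-- **Common denominators**: finitely many finite-adelic matrices are brought into `M_n(𝒪̂_K)`
by one non-zero integer of `K`. [cite: CasselsFrohlichANT1967, Ch. II §14] -/
theorem exists_ne_zero_forall_mul_entry_mem (s : Finset (GL n (FiniteAdeleRing (𝓞 K) K))) :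
    ∃ N : 𝓞 K, N ≠ 0 ∧ ∀ d ∈ s, ∀ i j,
      algebraMap (𝓞 K) (FiniteAdeleRing (𝓞 K) K) N * (d : Matrix n n (FiniteAdeleRing (𝓞 K) K)) i j ∈
        integralFiniteAdeles K := by
  classical
  -- one denominator per entry, multiplied together
  choose c hc0 hc using fun (p : s × n × n) =>
    Literature.NumberTheory.Automorphic.FiniteAdeleRing.exists_ne_zero_forall_mul_mem (𝓞 K) K
      ((p.1.1 : Matrix n n (FiniteAdeleRing (𝓞 K) K)) p.2.1 p.2.2)
  refine ⟨∏ p, c p, Finset.prod_ne_zero_iff.mpr fun p _ => hc0 p, fun d hd i j => ?_⟩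
  rw [mem_integralFiniteAdeles_iff]
  intro v
  have hsplit : (∏ p, c p) = (∏ p ∈ Finset.univ.erase (⟨d, hd⟩, i, j), c p) * c (⟨d, hd⟩, i, j) :=
    (Finset.prod_erase_mul _ _ (Finset.mem_univ _)).symm
  rw [hsplit, map_mul, mul_assoc, Literature.NumberTheory.Automorphic.FiniteAdeleRing.mul_apply']
  exact mul_mem (Literature.NumberTheory.Automorphic.algebraMap_mem_adicCompletionIntegers
    (𝓞 K) K v _) (hc (⟨d, hd⟩, i, j) v)

end General

/-! ### §2. `ℚ ∩ ℤ̂ = ℤ` and `𝔸_{ℚ,f} = ℚ + N ℤ̂` -/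

section RatAdeles

/-- `ℚ ∩ ℤ̂ = ℤ`: a rational number which is a `p`-adic integer for every `p` is an integer.
[cite: CasselsFrohlichANT1967, Ch. II §14] -/
theorem exists_int_cast_eq_of_mem_integralFiniteAdeles {q : ℚ}
    (hq : algebraMap ℚ (FiniteAdeleRing (𝓞 ℚ) ℚ) q ∈ integralFiniteAdeles ℚ) : ∃ z : ℤ, (z : ℚ) = q := by
  obtain ⟨r, hr⟩ := exists_algebraMap_eq_of_forall_coe_mem (𝓞 ℚ) ℚ q fun v => by
    rw [← FiniteAdeleRing.algebraMap_apply (R := 𝓞 ℚ)]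
    exact hq v
  exact ⟨Rat.ringOfIntegersEquiv r, by rw [Rat.ringOfIntegersEquiv_apply_coe, hr]⟩

/-- Integers are integral finite adeles. [cite: CasselsFrohlichANT1967, Ch. II §14] -/
theorem algebraMap_intCast_mem_integralFiniteAdeles (z : ℤ) :
    algebraMap ℚ (FiniteAdeleRing (𝓞 ℚ) ℚ) (z : ℚ) ∈ integralFiniteAdeles ℚ := fun v => by
  rw [FiniteAdeleRing.algebraMap_apply,
    show ((z : ℚ) : ℚ) = algebraMap (𝓞 ℚ) ℚ (z : 𝓞 ℚ) by rw [map_intCast]]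
  exact HeightOneSpectrum.coe_algebraMap_mem (𝓞 ℚ) ℚ v _

/-- **`𝔸_{ℚ,f} = ℚ + N ℤ̂`** (weak approximation with modulus): every finite adele is a rational
number plus `N` times an integral adele, for every `N ≠ 0`.
[cite: CasselsFrohlichANT1967, Ch. II §15] -/
theorem exists_rat_add_natCast_mul (N : ℕ) (hN : N ≠ 0) (a : FiniteAdeleRing (𝓞 ℚ) ℚ) :
    ∃ (k : ℚ) (y : FiniteAdeleRing (𝓞 ℚ) ℚ), y ∈ integralFiniteAdeles ℚ ∧
      a = algebraMap ℚ (FiniteAdeleRing (𝓞 ℚ) ℚ) k + (N : FiniteAdeleRing (𝓞 ℚ) ℚ) * y := by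
  obtain ⟨k, hk⟩ := Literature.NumberTheory.Automorphic.FiniteAdeleRing.exists_forall_sub_algebraMap_mem
    (𝓞 ℚ) ℚ (algebraMap ℚ (FiniteAdeleRing (𝓞 ℚ) ℚ) ((N : ℚ)⁻¹) * a)
  refine ⟨N * k, algebraMap ℚ _ ((N : ℚ)⁻¹) * a - algebraMap ℚ _ k, hk, ?_⟩
  have hNQ : (N : ℚ) ≠ 0 := Nat.cast_ne_zero.mpr hN
  have hNA : (N : FiniteAdeleRing (𝓞 ℚ) ℚ) = algebraMap ℚ (FiniteAdeleRing (𝓞 ℚ) ℚ) (N : ℚ) := by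
    rw [map_natCast]
  rw [hNA, mul_sub, ← mul_assoc, ← map_mul, ← map_mul, mul_inv_cancel₀ hNQ, map_one, one_mul]
  ring

end RatAdeles

/-! ### §3. Full-rank subgroups of `ℚⁿ` are free of rank `n`, with an invertible basis matrix -/

section Lattice

/-- The standard vectors `eᵢ` are linearly independent over `ℤ` in `ℚⁿ`. [folklore] -/
private theorem linearIndependent_rat_smul_single {c : ℚ} (hc : c ≠ 0) :
    LinearIndependent ℚ (fun i : n => (c • Pi.single i 1 : n → ℚ)) := by
  have h0 := (Pi.basisFun ℚ n).linearIndependent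
  have hfun : (fun i : n => (c • Pi.single i 1 : n → ℚ)) =
      (fun _ : n => Units.mk0 c hc) • ⇑(Pi.basisFun ℚ n) := by
    funext i
    simp [Units.smul_def, Pi.basisFun_apply]
  rw [hfun]
  exact h0.units_smul _

/-- `c • eᵢ` (`c ≠ 0`) are linearly independent over `ℤ` in `ℚⁿ`. [folklore] -/
private theorem linearIndependent_int_smul_single {c : ℚ} (hc : c ≠ 0) :
    LinearIndependent ℤ (fun i : n => (c • Pi.single i 1 : n → ℚ)) :=
  (linearIndependent_rat_smul_single hc).restrict_scalars (by
    intro a b hab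
    simpa using hab)

/-- **Full-rank lattices in `ℚⁿ` are free of rank `n`.**  A subgroup `Λ ≤ ℤⁿ ⊆ ℚⁿ` containing
`N eᵢ` for all `i` (`N ≠ 0`) has a `ℤ`-basis indexed by `n` (a submodule of the free
`ℤ`-module `ℤⁿ` over the PID `ℤ`, Mathlib `Submodule.basisOfPidOfLE`, squeezed between two free
modules of rank `n`). [cite: PlatonovRapinchuk1994, §8.1] -/
theorem nonempty_basis_of_sandwiched (Λ : Submodule ℤ (n → ℚ)) {N : ℕ} (hN : N ≠ 0)
    (hstd : ∀ i, ((N : ℚ) • Pi.single i 1 : n → ℚ) ∈ Λ)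
    (hint : ∀ q ∈ Λ, ∀ i, ∃ z : ℤ, (z : ℚ) = q i) :
    Nonempty (Module.Basis n ℤ Λ) := by
  classical
  -- `Λ ≤ O := ℤⁿ = span {eᵢ}`
  let O : Submodule ℤ (n → ℚ) :=
    Submodule.span ℤ (Set.range fun i : n => ((1 : ℚ) • Pi.single i 1 : n → ℚ))
  let bO : Module.Basis n ℤ O := Module.Basis.span (linearIndependent_int_smul_single one_ne_zero)
  have hΛO : Λ ≤ O := by
    intro q hq
    choose z hz using hint q hq
    have hq' : q = ∑ i, (z i : ℤ) • ((1 : ℚ) • Pi.single i 1 : n → ℚ) := by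
      funext j
      rw [Finset.sum_apply, Finset.sum_eq_single j]
      · simp [← hz j]
      · intro i _ hij
        simp [hij.symm]
      · intro hj; exact absurd (Finset.mem_univ j) hj
    rw [hq']
    exact Submodule.sum_mem _ fun i _ =>
      Submodule.smul_mem _ _ (Submodule.subset_span (Set.mem_range_self i))
  obtain ⟨m, bΛ⟩ := Submodule.basisOfPidOfLE hΛO bO
  -- rank count: `card n ≤ m ≤ card n`
  haveI : Module.Finite ℤ O := Module.Finite.of_basis bO
  haveI : Module.Finite ℤ Λ := Module.Finite.of_basis bΛ
  have h1 : Module.finrank ℤ Λ ≤ Fintype.card n := by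
    have := Submodule.finrank_mono hΛO
    rwa [Module.finrank_eq_card_basis bO] at this
  have h2 : Fintype.card n ≤ Module.finrank ℤ Λ := by
    let Λ₀ : Submodule ℤ (n → ℚ) :=
      Submodule.span ℤ (Set.range fun i : n => ((N : ℚ) • Pi.single i 1 : n → ℚ))
    have hli : LinearIndependent ℤ (fun i : n => ((N : ℚ) • Pi.single i 1 : n → ℚ)) :=
      linearIndependent_int_smul_single (Nat.cast_ne_zero.mpr hN)
    let b₀ : Module.Basis n ℤ Λ₀ := Module.Basis.span hli
    have hle : Λ₀ ≤ Λ := Submodule.span_le.2 (by rintro _ ⟨i, rfl⟩; exact hstd i)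
    have := Submodule.finrank_mono hle
    rwa [Module.finrank_eq_card_basis b₀] at this
  have hm : m = Fintype.card n := by
    have := Module.finrank_eq_card_basis bΛ
    rw [Fintype.card_fin] at this
    omega
  exact ⟨bΛ.reindex (Fintype.equivFinOfCardEq hm.symm).symm⟩

end Lattice

/-! ### §4. The theorem -/

section Main

omit [DecidableEq n] in
/-- Integral matrices send integral vectors to integral vectors. [folklore] -/
private theorem mulVec_mem {M : Matrix n n (FiniteAdeleRing (𝓞 ℚ) ℚ)}
    (hM : ∀ i j, M i j ∈ integralFiniteAdeles ℚ) {y : n → FiniteAdeleRing (𝓞 ℚ) ℚ}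
    (hy : ∀ j, y j ∈ integralFiniteAdeles ℚ) (i : n) : (M *ᵥ y) i ∈ integralFiniteAdeles ℚ := by
  rw [Matrix.mulVec, dotProduct]
  exact sum_mem fun j _ => mul_mem (hM i j) (hy j)

/-- **Compact subgroups of `GL_n(𝔸_{ℚ,f})` are `GL_n(ℚ)`-conjugate into `GL_n(ℤ̂)`.**  For a
compact subgroup `C ≤ GL_n(𝔸_{ℚ,f})` there is `γ ∈ GL_n(ℚ)` such that for every `c ∈ C` the
matrices `γ c γ⁻¹` and `γ c⁻¹ γ⁻¹` have all their entries in `ℤ̂ = ∏_p ℤ_p` — equivalently the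
full `ℤ`-lattice `Λ = γ⁻¹ ℤⁿ` satisfies `c Λ̂ = Λ̂` for all `c ∈ C` (class number one of `GL_n`
over `ℚ`; the lattice is `Λ = {q ∈ ℚⁿ | C q ⊆ ℤ̂ⁿ}`). [cite: PlatonovRapinchuk1994, §8.1] -/
theorem exists_rat_conj_entries_mem_integralFiniteAdeles
    (C : Subgroup (GL n (FiniteAdeleRing (𝓞 ℚ) ℚ)))
    (hC : IsCompact (C : Set (GL n (FiniteAdeleRing (𝓞 ℚ) ℚ)))) :
    ∃ γ : GL n ℚ, ∀ c ∈ C,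
      (∀ i j, ((Matrix.GeneralLinearGroup.map (algebraMap ℚ (FiniteAdeleRing (𝓞 ℚ) ℚ)) γ * c *
          (Matrix.GeneralLinearGroup.map (algebraMap ℚ (FiniteAdeleRing (𝓞 ℚ) ℚ)) γ)⁻¹ :
            GL n (FiniteAdeleRing (𝓞 ℚ) ℚ)) : Matrix n n (FiniteAdeleRing (𝓞 ℚ) ℚ)) i j ∈
          integralFiniteAdeles ℚ) ∧
      (∀ i j, ((Matrix.GeneralLinearGroup.map (algebraMap ℚ (FiniteAdeleRing (𝓞 ℚ) ℚ)) γ * c⁻¹ *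
          (Matrix.GeneralLinearGroup.map (algebraMap ℚ (FiniteAdeleRing (𝓞 ℚ) ℚ)) γ)⁻¹ :
            GL n (FiniteAdeleRing (𝓞 ℚ) ℚ)) : Matrix n n (FiniteAdeleRing (𝓞 ℚ) ℚ)) i j ∈
          integralFiniteAdeles ℚ) := by
  classical
  -- notation-free abbreviations
  let A := FiniteAdeleRing (𝓞 ℚ) ℚ
  let f : ℚ →+* A := algebraMap ℚ A
  let O := integralFiniteAdeles ℚ
  -- §1: finitely many cosets of `C ∩ GL_n(ℤ̂)` and a common denominator `N`
  obtain ⟨s, hsC, hcov⟩ := exists_finset_cosets_of_isCompact (n := n) ℚ C hC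
  obtain ⟨N₀, hN₀, hden⟩ := exists_ne_zero_forall_mul_entry_mem (n := n) ℚ s
  let N : ℕ := (Rat.ringOfIntegersEquiv N₀).natAbs
  have hN : N ≠ 0 := by
    intro h
    apply hN₀
    have : Rat.ringOfIntegersEquiv N₀ = 0 := Int.natAbs_eq_zero.mp h
    exact Rat.ringOfIntegersEquiv.injective (by rw [this, map_zero])
  have hNf : (N : A) = f (N : ℚ) := by rw [map_natCast]
  have hNint : ∀ d ∈ s, ∀ i j, (N : A) * (d : Matrix n n A) i j ∈ O := by
    intro d hd i j
    have h := hden d hd i j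
    set z : ℤ := Rat.ringOfIntegersEquiv N₀ with hzdef
    have hN₀A : algebraMap (𝓞 ℚ) A N₀ = f (z : ℚ) := by
      rw [IsScalarTower.algebraMap_apply (𝓞 ℚ) ℚ A, hzdef, Rat.ringOfIntegersEquiv_apply_coe]
    rw [hN₀A] at h
    have hNz : (N : ℚ) = ((z.natAbs : ℤ) : ℚ) := (Int.cast_natCast z.natAbs).symm
    rcases le_total 0 z with h0 | h0
    · rw [hNf, hNz, Int.natAbs_of_nonneg h0]
      exact h
    · rw [hNf, hNz, Int.ofNat_natAbs_of_nonpos h0, Int.cast_neg, map_neg, neg_mul]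
      exact neg_mem h
  -- the `C`-stable integrality predicate `L̂`
  let L : (n → A) → Prop := fun x => ∀ c ∈ C, ∀ i, ((c : Matrix n n A) *ᵥ x) i ∈ O
  have hL_int : ∀ {x}, L x → ∀ i, x i ∈ O := fun {x} hx i => by
    have := hx 1 C.one_mem i
    rwa [Units.val_one, Matrix.one_mulVec] at this
  have hL_N : ∀ {y : n → A}, (∀ j, y j ∈ O) → L (fun j => (N : A) * y j) := by
    intro y hy c hc i
    obtain ⟨d, hd, hu⟩ := hcov c hc
    rw [mem_units_matrix_integralFiniteAdeles_iff] at hu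
    have hc' : (c : Matrix n n A) = (d : Matrix n n A) * ((d⁻¹ * c : GL n A) : Matrix n n A) := by
      rw [← Units.val_mul, mul_inv_cancel_left]
    rw [hc', ← Matrix.mulVec_mulVec]
    -- `d *ᵥ (u *ᵥ (N y)) = Σ_j (N d i j) * (u *ᵥ y) j`
    have hw : ∀ j, (((d⁻¹ * c : GL n A) : Matrix n n A) *ᵥ y) j ∈ O := fun j => mulVec_mem hu.1 hy j
    have : (((d⁻¹ * c : GL n A) : Matrix n n A) *ᵥ fun j => (N : A) * y j) =
        fun j => (N : A) * (((d⁻¹ * c : GL n A) : Matrix n n A) *ᵥ y) j := by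
      funext j
      simp only [Matrix.mulVec, dotProduct, Finset.mul_sum]
      refine Finset.sum_congr rfl fun k _ => by ring
    rw [this, Matrix.mulVec, dotProduct]
    exact sum_mem fun j _ => by
      rw [← mul_assoc, mul_comm ((d : Matrix n n A) i j)]
      exact mul_mem (hNint d hd i j) (hw j)
  have hL_mul : ∀ {x}, L x → ∀ c ∈ C, L ((c : Matrix n n A) *ᵥ x) := by
    intro x hx c hc c' hc' i
    rw [Matrix.mulVec_mulVec, ← Units.val_mul]
    exact hx (c' * c) (C.mul_mem hc' hc) i
  have hL_add : ∀ {x y}, L x → L y → L (x + y) := fun hx hy c hc i => by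
    rw [Matrix.mulVec_add, Pi.add_apply]; exact add_mem (hx c hc i) (hy c hc i)
  have hL_sub : ∀ {x y}, L x → L y → L (x - y) := fun hx hy c hc i => by
    rw [Matrix.mulVec_sub, Pi.sub_apply]; exact sub_mem (hx c hc i) (hy c hc i)
  have hL_zero : L 0 := fun c hc i => by rw [Matrix.mulVec_zero]; exact zero_mem _
  have hL_smul : ∀ {x} (a : A), a ∈ O → L x → L (a • x) := fun a ha hx c hc i => by
    rw [Matrix.mulVec_smul, Pi.smul_apply, smul_eq_mul]; exact mul_mem ha (hx c hc i)
  -- the rational lattice `Λ = {q ∈ ℚⁿ | C q ⊆ ℤ̂ⁿ}`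
  let Λ : Submodule ℤ (n → ℚ) :=
    { carrier := {q | L (fun j => f (q j))}
      add_mem' := fun {q q'} hq hq' => by
        change L (fun j => f ((q + q') j))
        convert hL_add hq hq' using 1
        funext j
        simp only [Pi.add_apply, map_add]
      zero_mem' := by
        change L (fun j => f ((0 : n → ℚ) j))
        convert hL_zero using 1
        funext j
        simp only [Pi.zero_apply, map_zero]
      smul_mem' := fun z q hq => by
        change L (fun j => f ((z • q) j))
        convert hL_smul (f (z : ℚ)) (algebraMap_intCast_mem_integralFiniteAdeles z) hq using 1
        funext j
        simp only [Pi.smul_apply, zsmul_eq_mul, map_mul, map_intCast, smul_eq_mul] }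
  have hΛ_mem : ∀ {q : n → ℚ}, q ∈ Λ ↔ L (fun j => f (q j)) := Iff.rfl
  have hΛint : ∀ q ∈ Λ, ∀ i, ∃ z : ℤ, (z : ℚ) = q i := fun q hq i =>
    exists_int_cast_eq_of_mem_integralFiniteAdeles (hL_int (hΛ_mem.mp hq) i)
  have hfsingle : ∀ (i j : n), f ((Pi.single i 1 : n → ℚ) j) ∈ O := fun i j => by
    rw [Pi.single_apply]
    split_ifs
    · rw [map_one]; exact one_mem _
    · rw [map_zero]; exact zero_mem _
  have hΛstd : ∀ i, ((N : ℚ) • Pi.single i 1 : n → ℚ) ∈ Λ := fun i => by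
    rw [hΛ_mem]
    have := hL_N (hfsingle i)
    convert this using 2 with j
    rw [Pi.smul_apply, smul_eq_mul, map_mul, hNf]
  -- a `ℤ`-basis of `Λ` and its matrix `B`
  obtain ⟨b⟩ := nonempty_basis_of_sandwiched Λ hN hΛstd hΛint
  let B : Matrix n n ℚ := fun i j => ((b j : Λ) : n → ℚ) i
  have hBcol : ∀ j, L (fun i => f (B i j)) := fun j => hΛ_mem.mp (b j).2
  have hBspan : ∀ q ∈ Λ, ∃ z : n → ℤ, q = B *ᵥ fun j => (z j : ℚ) := by
    intro q hq
    refine ⟨fun j => b.repr ⟨q, hq⟩ j, ?_⟩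
    have h := b.sum_repr ⟨q, hq⟩
    have h' : q = ∑ j, (b.repr ⟨q, hq⟩ j : ℤ) • ((b j : Λ) : n → ℚ) := by
      have := congrArg (fun x : Λ => (x : n → ℚ)) h
      simpa only [Submodule.coe_sum, Submodule.coe_smul_of_tower] using this.symm
    funext i
    rw [congrFun h' i, Finset.sum_apply, Matrix.mulVec, dotProduct]
    refine Finset.sum_congr rfl fun j _ => ?_
    rw [Pi.smul_apply, zsmul_eq_mul, mul_comm]
  -- `B Z = N · 1` for an integer matrix `Z`
  choose zcol hzcol using fun j => hBspan _ (hΛstd j)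
  let Zc : Matrix n n ℚ := fun i j => (zcol j i : ℚ)
  have hBZ : B * Zc = (N : ℚ) • (1 : Matrix n n ℚ) := by
    ext i j
    have h := congrFun (hzcol j) i
    rw [Pi.smul_apply, smul_eq_mul] at h
    rw [Matrix.mul_apply, Matrix.smul_apply, smul_eq_mul, Matrix.one_apply, Pi.single_apply] at *
    rw [h, Matrix.mulVec, dotProduct]
  have hNQ : (N : ℚ) ≠ 0 := Nat.cast_ne_zero.mpr hN
  let Binv : Matrix n n ℚ := (N : ℚ)⁻¹ • Zc
  have hBBinv : B * Binv = 1 := by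
    rw [Matrix.mul_smul, hBZ, smul_smul, inv_mul_cancel₀ hNQ, one_smul]
  have hBinvB : Binv * B = 1 := mul_eq_one_comm.mp hBBinv
  let γ : GL n ℚ := ⟨Binv, B, hBinvB, hBBinv⟩
  -- adelic images
  have hγA : ((Matrix.GeneralLinearGroup.map f γ : GL n A) : Matrix n n A) = Binv.map f := rfl
  have hγAinv : ((Matrix.GeneralLinearGroup.map f γ)⁻¹ : GL n A) = Matrix.GeneralLinearGroup.map f γ⁻¹ :=
    (map_inv _ γ).symm
  have hγAinv' : (((Matrix.GeneralLinearGroup.map f γ)⁻¹ : GL n A) : Matrix n n A) = B.map f := by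
    rw [hγAinv]; rfl
  have hBinvBA : Binv.map f * B.map f = 1 := by
    rw [← RingHom.mapMatrix_apply, ← RingHom.mapMatrix_apply, ← map_mul, hBinvB, map_one]
  -- KEY: `B⁻¹ L̂ ⊆ ℤ̂ⁿ` (strong approximation `𝔸_f = ℚ + N ℤ̂`)
  have hkey : ∀ {x : n → A}, L x → ∀ i, (Binv.map f *ᵥ x) i ∈ O := by
    intro x hx i
    choose k y hy hxy using fun j => exists_rat_add_natCast_mul N hN (x j)
    have hx_split : x = (fun j => f (k j)) + fun j => (N : A) * y j := funext hxy
    have hxN : L (fun j => (N : A) * y j) := hL_N hy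
    have hk : L (fun j => f (k j)) := by
      have := hL_sub hx hxN
      rwa [hx_split, add_sub_cancel_right] at this
    obtain ⟨z, hz⟩ := hBspan k (hΛ_mem.mpr hk)
    -- `B⁻¹ (f k) = f z`
    have h1 : Binv.map f *ᵥ (fun j => f (k j)) = fun j => f (z j : ℚ) := by
      have hfk : (fun j => f (k j)) = B.map f *ᵥ fun j => f (z j : ℚ) := by
        funext j
        rw [hz]
        exact RingHom.map_mulVec f B (fun j => (z j : ℚ)) j
      rw [hfk, Matrix.mulVec_mulVec, hBinvBA, Matrix.one_mulVec]
    -- `B⁻¹ (N y) = Z y`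
    have h2 : ∀ i, (Binv.map f *ᵥ fun j => (N : A) * y j) i ∈ O := by
      intro i
      rw [Matrix.mulVec, dotProduct]
      refine sum_mem fun j _ => ?_
      rw [Matrix.map_apply, show Binv i j = (N : ℚ)⁻¹ * Zc i j from rfl, map_mul, hNf,
        show f (N : ℚ)⁻¹ * f (Zc i j) * (f (N : ℚ) * y j) = f ((N : ℚ)⁻¹ * (N : ℚ)) * (f (Zc i j) * y j) by
          rw [map_mul]; ring,
        inv_mul_cancel₀ hNQ, map_one, one_mul]
      exact mul_mem (algebraMap_intCast_mem_integralFiniteAdeles _) (hy j)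
    rw [hx_split, Matrix.mulVec_add, Pi.add_apply, h1]
    exact add_mem (algebraMap_intCast_mem_integralFiniteAdeles _) (h2 i)
  -- conclusion
  have hconj : ∀ c ∈ C, ∀ i j,
      (Binv.map f * (c : Matrix n n A) * B.map f) i j ∈ O := by
    intro c hc i j
    have hcol : (Binv.map f * (c : Matrix n n A) * B.map f) i j =
        ((Binv.map f * (c : Matrix n n A) * B.map f) *ᵥ (Pi.single j 1 : n → A)) i := by
      simp [Matrix.mulVec, dotProduct, Pi.single_apply]
    rw [hcol, ← Matrix.mulVec_mulVec, ← Matrix.mulVec_mulVec]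
    refine hkey (hL_mul ?_ c hc) i
    have : (B.map f *ᵥ (Pi.single j 1 : n → A)) = fun i => f (B i j) := by
      funext i
      simp [Matrix.mulVec, dotProduct, Pi.single_apply, Matrix.map_apply]
    rw [this]
    exact hBcol j
  refine ⟨γ, fun c hc => ⟨fun i j => ?_, fun i j => ?_⟩⟩
  · rw [Units.val_mul, Units.val_mul, hγA, hγAinv']
    exact hconj c hc i j
  · rw [Units.val_mul, Units.val_mul, hγA, hγAinv']
    exact hconj c⁻¹ (C.inv_mem hc) i j

end Main

/-! ### §5. The receptacle's currency: `IsCongOne 1` (entries of `γ c γ⁻¹` and `γ c⁻¹ γ⁻¹` in `ℤ̂`) -/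

section SiegelCurrency

/-- `𝒪̂` (integral at every place) is the range `∏_v 𝒪_v → 𝔸_{ℚ,f}` of the structure map, in the
spelling `FiniteAdeleRing.integralAdeles` of the Siegel levels. [folklore] -/
private theorem mem_integralAdeles_of_mem {x : FiniteAdeleRing (𝓞 ℚ) ℚ}
    (hx : x ∈ integralFiniteAdeles ℚ) : x ∈ FiniteAdeleRing.integralAdeles (𝓞 ℚ) ℚ := by
  exact ⟨fun v => ⟨x v, hx v⟩, FiniteAdeleRing.ext _ fun v => rfl⟩

omit [Fintype n] in
/-- An adelic matrix with entries in `𝒪̂` is `≡ 1 (mod 1·𝒪̂)`, i.e. `IsCongOne 1` in the currency of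
`SiegelComplexRecordSystem` (whose `levelIdeal 1 = 𝒪̂`). [folklore] -/
private theorem isCongOne_one_of_forall_mem {M : Matrix n n (FiniteAdeleRing (𝓞 ℚ) ℚ)}
    (hM : ∀ i j, M i j ∈ integralFiniteAdeles ℚ) : IsCongOne 1 M := by
  intro i j
  rw [mem_levelIdeal_iff]
  refine ⟨(M - 1) i j, mem_integralAdeles_of_mem ?_, by rw [Nat.cast_one, one_mul]⟩
  rw [Matrix.sub_apply]
  refine sub_mem (hM i j) ?_
  rw [Matrix.one_apply]
  split_ifs
  · exact one_mem _
  · exact zero_mem _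

/-- **Compact subgroups of `GL_n(𝔸_{ℚ,f})` are `GL_n(ℚ)`-conjugate into `GL_n(ℤ̂)`** — the
receptacle's spelling (B-plan2, leaf Q6a of the I-1′ line): for a compact subgroup
`C ≤ GL_n(𝔸_{ℚ,f})` there is `γ ∈ GL_n(ℚ)` such that for every `c ∈ C` the matrices `γ_𝔸 c γ_𝔸⁻¹`
and `γ_𝔸 c⁻¹ γ_𝔸⁻¹` (`γ_𝔸 = GeneralLinearGroup.map (algebraMap ℚ 𝔸_{ℚ,f}) γ`) are `IsCongOne 1`,
i.e. `γ C γ⁻¹ ≤ GL_n(ℤ̂)`; equivalently `Λ := γ⁻¹ ℤⁿ` has `c • Λ̂ = Λ̂` for all `c ∈ C`.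
[cite: PlatonovRapinchuk1994, §8.1] -/
theorem exists_rat_conj_isCongOne_one (C : Subgroup (GL n finAdeleQ))
    (hC : IsCompact (C : Set (GL n finAdeleQ))) :
    ∃ γ : GL n ℚ, ∀ c ∈ C,
      IsCongOne 1 ((Matrix.GeneralLinearGroup.map (algebraMap ℚ finAdeleQ) γ * c *
          (Matrix.GeneralLinearGroup.map (algebraMap ℚ finAdeleQ) γ)⁻¹ : GL n finAdeleQ) :
            Matrix n n finAdeleQ) ∧
      IsCongOne 1 ((Matrix.GeneralLinearGroup.map (algebraMap ℚ finAdeleQ) γ * c⁻¹ *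
          (Matrix.GeneralLinearGroup.map (algebraMap ℚ finAdeleQ) γ)⁻¹ : GL n finAdeleQ) :
            Matrix n n finAdeleQ) := by
  obtain ⟨γ, hγ⟩ := exists_rat_conj_entries_mem_integralFiniteAdeles C hC
  exact ⟨γ, fun c hc => ⟨isCongOne_one_of_forall_mem (hγ c hc).1,
    isCongOne_one_of_forall_mem (hγ c hc).2⟩⟩

end SiegelCurrency

end Literature.NumberTheory.Adeles

end
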